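import Summits.QuantumFields.GaugeBoot.SOMasterLoopContraction
import HarnessLib

/-!
# `𝔰𝔬(N)` contractions of inserted products: the pair shapes of the master loop equation (gauge-boot, ADDENDUM 27 part M4b)

HONEST FRAMING (cell `pub-gaugeboot`, page 1 of every file): the venture produces certified bounds
on lattice expectations at stated coupling, gauge group, dimension and torus size; NOT a mass gap,
NOT a continuum limit, NOT a string tension; NOT Yang–Mills-summit-bearing (barriers
`FixedCouplingUltralocality`, `PerturbativeInvisibility`).  Pure matrix algebra over a commutative ring; nothing about a
lattice theory is claimed here.

## Content

Sixth file of the lane's programme on the tree's NAMED FACT `Chatterjee2019LargeN.UnsymmetrizedMasterLoopEquation`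
(Chatterjee, CMP 366 (2019), Theorem 8.1).  In the differentiated one-link identity summed over the antisymmetric units
`X = X_ij` (part M1), an insertion at a forward traversal of the link is `X·M`, at a backward one `−M·X` (`M` the
orthogonal letter matrix, `Mᵀ M = M Mᵀ = 1`; the backward letter matrix is the transpose of the forward one).
Contracting `Σ_ij` in the trace formulas of part M4a gives the following shapes, all instances of
`Σ X A X = 2(Aᵀ − tr A)`, `Σ X X = −2(N−1)` and `Σ tr(XA) tr(XB) = 2(tr(ABᵀ) − tr(AB))`:

* DIAGONAL (Casimir): `sum_trace_fwd_fwd_same_slot`, `sum_trace_bwd_bwd_same_slot` — `−2(N−1)·tr(M T)`;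
* SAME LETTER at two slots (→ negative twisting / positive splitting): `sum_trace_pair_fwd_fwd`, `sum_trace_pair_bwd_bwd`
  — `2(tr(Aᵀ B) − tr(MA)·tr(MB))` resp. `2(tr(Aᵀ B) − tr(AM)·tr(BM))`;
* INVERSE LETTERS at two slots (→ positive twisting / negative splitting): `sum_trace_pair_fwd_bwd`,
  `sum_trace_pair_bwd_fwd` — `−2(tr(M Aᵀ Mᵀ B) − tr A · tr B)`;
* TWO WORDS (→ mergers, deformations): `sum_trace_mul_trace_fwd_fwd`, `…_bwd_bwd` — `2(tr(T T'ᵀ) − tr(M T M T'))`;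
  `…_fwd_bwd`, `…_bwd_fwd` — `2(tr(T T') − tr(M T M T'ᵀ))`.

References: S. Chatterjee, Comm. Math. Phys. 366 (2019) §§6–8 (the same case analysis through Stein's equation).
Everything is `[folklore]`.
-/

namespace Summit.QuantumFields.GaugeBoot

namespace SOMasterLoop

open Matrix

variable {n : Type*} [Fintype n] [DecidableEq n] {R : Type*} [CommRing R]

/-! ## Diagonal (Casimir) shapes -/

/-- `Σ_ij tr((X X M) T) = −2(N−1) tr(M T)` (double insertion at a forward slot). [folklore] -/
theorem sum_trace_fwd_fwd_same_slot (M T : Matrix n n R) :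
    ∑ i : n, ∑ j : n, (soDir i j * soDir i j * M * T).trace = -(2 * ((Fintype.card n : R) - 1)) * (M * T).trace := by
  have h : ∀ i j : n, (soDir i j * soDir i j * M * T : Matrix n n R) = soDir i j * soDir i j * (M * T) := by
    intro i j; rw [Matrix.mul_assoc]
  simp only [h, sum_trace_soDir_mul_soDir_mul]

/-- `Σ_ij tr((M X X) T) = −2(N−1) tr(M T)` (double insertion at a backward slot). [folklore] -/
theorem sum_trace_bwd_bwd_same_slot (M T : Matrix n n R) :
    ∑ i : n, ∑ j : n, (M * soDir i j * soDir i j * T).trace = -(2 * ((Fintype.card n : R) - 1)) * (M * T).trace := by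
  have h : ∀ i j : n, (M * soDir i j * soDir i j * T).trace = ((soDir i j * soDir i j * (T * M)) : Matrix n n R).trace := by
    intro i j
    calc (M * soDir i j * soDir i j * T).trace = (M * (soDir i j * soDir i j * T)).trace := by simp only [Matrix.mul_assoc]
      _ = (soDir i j * soDir i j * T * M).trace := Matrix.trace_mul_comm _ _
      _ = (soDir i j * soDir i j * (T * M)).trace := by rw [Matrix.mul_assoc]
  simp only [h, sum_trace_soDir_mul_soDir_mul, Matrix.trace_mul_comm T M]

/-! ## Two slots of one word -/

/-- Same forward letter at both slots: `Σ_ij tr((XM) A (XM) B) = 2(tr(Aᵀ B) − tr(MA) tr(MB))` for orthogonal `M`.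
[folklore] -/
theorem sum_trace_pair_fwd_fwd (M A B : Matrix n n R) (hM : Mᵀ * M = 1) :
    ∑ i : n, ∑ j : n, (soDir i j * M * A * (soDir i j * M) * B).trace =
      2 * ((Aᵀ * B).trace - (M * A).trace * (M * B).trace) := by
  have h : ∀ i j : n, (soDir i j * M * A * (soDir i j * M) * B : Matrix n n R) =
      soDir i j * (M * A) * soDir i j * (M * B) := by
    intro i j; simp only [Matrix.mul_assoc]
  simp only [h, sum_trace_soDir_sandwich]
  rw [Matrix.transpose_mul, Matrix.mul_assoc, ← Matrix.mul_assoc Mᵀ, hM, Matrix.one_mul]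

/-- Same backward letter at both slots: `Σ_ij tr((−MX) A (−MX) B) = 2(tr(Aᵀ B) − tr(AM) tr(BM))` for orthogonal `M`.
[folklore] -/
theorem sum_trace_pair_bwd_bwd (M A B : Matrix n n R) (hM' : M * Mᵀ = 1) :
    ∑ i : n, ∑ j : n, (-(M * soDir i j) * A * -(M * soDir i j) * B).trace =
      2 * ((Aᵀ * B).trace - (A * M).trace * (B * M).trace) := by
  have h : ∀ i j : n, (-(M * soDir i j) * A * -(M * soDir i j) * B : Matrix n n R).trace =
      (soDir i j * (A * M) * soDir i j * (B * M)).trace := by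
    intro i j
    have e : (-(M * soDir i j) * A * -(M * soDir i j) * B : Matrix n n R) = M * soDir i j * A * (M * soDir i j) * B := by
      simp only [Matrix.neg_mul, Matrix.mul_neg, neg_neg]
    rw [e]
    calc (M * soDir i j * A * (M * soDir i j) * B).trace = (M * (soDir i j * A * M * soDir i j * B)).trace := by
          simp only [Matrix.mul_assoc]
      _ = (soDir i j * A * M * soDir i j * B * M).trace := Matrix.trace_mul_comm _ _
      _ = (soDir i j * (A * M) * soDir i j * (B * M)).trace := by simp only [Matrix.mul_assoc]
  simp only [h, sum_trace_soDir_sandwich]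
  congr 2
  rw [Matrix.transpose_mul]
  calc (Mᵀ * Aᵀ * (B * M)).trace = (Mᵀ * (Aᵀ * B * M)).trace := by simp only [Matrix.mul_assoc]
    _ = (Aᵀ * B * M * Mᵀ).trace := Matrix.trace_mul_comm _ _
    _ = (Aᵀ * B).trace := by rw [Matrix.mul_assoc (Aᵀ * B), hM', Matrix.mul_one]

/-- Forward letter (matrix `M`) at the first slot, the inverse letter backward (matrix `Mᵀ`) at the second:
`Σ_ij tr((XM) A (−Mᵀ X) B) = −2(tr(M Aᵀ Mᵀ B) − tr A tr B)`. [folklore] -/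
theorem sum_trace_pair_fwd_bwd (M A B : Matrix n n R) (hM : Mᵀ * M = 1) :
    ∑ i : n, ∑ j : n, (soDir i j * M * A * -(Mᵀ * soDir i j) * B).trace =
      -(2 * ((M * Aᵀ * Mᵀ * B).trace - A.trace * B.trace)) := by
  have h : ∀ i j : n, (soDir i j * M * A * -(Mᵀ * soDir i j) * B : Matrix n n R).trace =
      -(soDir i j * (M * A * Mᵀ) * soDir i j * B).trace := by
    intro i j
    rw [Matrix.mul_neg, Matrix.neg_mul, Matrix.trace_neg]
    simp only [Matrix.mul_assoc]
  simp only [h, Finset.sum_neg_distrib, sum_trace_soDir_sandwich]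
  have h1 : ((M * A * Mᵀ)ᵀ * B).trace = (M * Aᵀ * Mᵀ * B).trace := by
    rw [Matrix.transpose_mul, Matrix.transpose_mul, Matrix.transpose_transpose]
    simp only [Matrix.mul_assoc]
  have h2 : (M * A * Mᵀ).trace = A.trace := by
    calc (M * A * Mᵀ).trace = (M * (A * Mᵀ)).trace := by rw [Matrix.mul_assoc]
      _ = (A * Mᵀ * M).trace := Matrix.trace_mul_comm _ _
      _ = A.trace := by rw [Matrix.mul_assoc, hM, Matrix.mul_one]
  rw [h1, h2]

/-- Backward letter (matrix `M`) at the first slot, the inverse letter forward (matrix `Mᵀ`) at the second: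
`Σ_ij tr((−MX) A (X Mᵀ) B) = −2(tr(M Aᵀ Mᵀ B) − tr A tr B)`. [folklore] -/
theorem sum_trace_pair_bwd_fwd (M A B : Matrix n n R) (hM' : M * Mᵀ = 1) :
    ∑ i : n, ∑ j : n, (-(M * soDir i j) * A * (soDir i j * Mᵀ) * B).trace =
      -(2 * ((M * Aᵀ * Mᵀ * B).trace - A.trace * B.trace)) := by
  have h : ∀ i j : n, (-(M * soDir i j) * A * (soDir i j * Mᵀ) * B : Matrix n n R).trace =
      -(soDir i j * A * soDir i j * (Mᵀ * B * M)).trace := by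
    intro i j
    have e : (-(M * soDir i j) * A * (soDir i j * Mᵀ) * B : Matrix n n R) = -(M * soDir i j * A * (soDir i j * Mᵀ) * B) := by
      simp only [Matrix.neg_mul]
    have e2 : (M * soDir i j * A * (soDir i j * Mᵀ) * B).trace = (soDir i j * A * soDir i j * (Mᵀ * B * M)).trace := by
      calc (M * soDir i j * A * (soDir i j * Mᵀ) * B).trace = (M * (soDir i j * A * soDir i j * Mᵀ * B)).trace := by
            simp only [Matrix.mul_assoc]
        _ = (soDir i j * A * soDir i j * Mᵀ * B * M).trace := Matrix.trace_mul_comm _ _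
        _ = (soDir i j * A * soDir i j * (Mᵀ * B * M)).trace := by simp only [Matrix.mul_assoc]
    rw [e, Matrix.trace_neg, e2]
  simp only [h, Finset.sum_neg_distrib, sum_trace_soDir_sandwich]
  have h1 : (Aᵀ * (Mᵀ * B * M)).trace = (M * Aᵀ * Mᵀ * B).trace := by
    calc (Aᵀ * (Mᵀ * B * M)).trace = (Aᵀ * Mᵀ * B * M).trace := by simp only [Matrix.mul_assoc]
      _ = (M * (Aᵀ * Mᵀ * B)).trace := (Matrix.trace_mul_comm _ _).symm
      _ = (M * Aᵀ * Mᵀ * B).trace := by simp only [Matrix.mul_assoc]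
  have h2 : (Mᵀ * B * M).trace = B.trace := by
    calc (Mᵀ * B * M).trace = (Mᵀ * (B * M)).trace := by rw [Matrix.mul_assoc]
      _ = (B * M * Mᵀ).trace := Matrix.trace_mul_comm _ _
      _ = B.trace := by rw [Matrix.mul_assoc, hM', Matrix.mul_one]
  rw [h1, h2]

/-! ## Two words (mergers and deformations) -/

/-- Both forward: `Σ_ij tr((XM)T)·tr((XM)T') = 2(tr(T T'ᵀ) − tr(M T M T'))`. [folklore] -/
theorem sum_trace_mul_trace_fwd_fwd (M T T' : Matrix n n R) (hM : Mᵀ * M = 1) :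
    ∑ i : n, ∑ j : n, (soDir i j * M * T).trace * (soDir i j * M * T').trace =
      2 * ((T * T'ᵀ).trace - (M * T * (M * T')).trace) := by
  simp only [Matrix.mul_assoc, sum_trace_soDir_mul_mul_trace_soDir_mul]
  have h1 : (M * (T * (M * T')ᵀ)).trace = (T * T'ᵀ).trace := by
    rw [Matrix.transpose_mul]
    calc (M * (T * (T'ᵀ * Mᵀ))).trace = (T * (T'ᵀ * Mᵀ) * M).trace := Matrix.trace_mul_comm _ _
      _ = (T * T'ᵀ * (Mᵀ * M)).trace := by simp only [Matrix.mul_assoc]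
      _ = (T * T'ᵀ).trace := by rw [hM, Matrix.mul_one]
  rw [h1]

/-- Both backward: `Σ_ij tr((−MX)T)·tr((−MX)T') = 2(tr(T T'ᵀ) − tr(M T M T'))`. [folklore] -/
theorem sum_trace_mul_trace_bwd_bwd (M T T' : Matrix n n R) (hM' : M * Mᵀ = 1) :
    ∑ i : n, ∑ j : n, (-(M * soDir i j) * T).trace * (-(M * soDir i j) * T').trace =
      2 * ((T * T'ᵀ).trace - (M * T * (M * T')).trace) := by
  have h : ∀ (i j : n) (S : Matrix n n R), (-(M * soDir i j) * S).trace = -(soDir i j * (S * M)).trace := by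
    intro i j S
    rw [Matrix.neg_mul, Matrix.trace_neg, Matrix.mul_assoc, Matrix.trace_mul_comm, Matrix.mul_assoc]
  simp only [h, neg_mul_neg, sum_trace_soDir_mul_mul_trace_soDir_mul]
  have h1 : (T * M * (T' * M)ᵀ).trace = (T * T'ᵀ).trace := by
    rw [Matrix.transpose_mul]
    calc (T * M * (Mᵀ * T'ᵀ)).trace = (T * (M * Mᵀ) * T'ᵀ).trace := by simp only [Matrix.mul_assoc]
      _ = (T * T'ᵀ).trace := by rw [hM', Matrix.mul_one]
  have h2 : (T * M * (T' * M)).trace = (M * T * (M * T')).trace := by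
    calc (T * M * (T' * M)).trace = (T * M * T' * M).trace := by simp only [Matrix.mul_assoc]
      _ = (M * (T * M * T')).trace := (Matrix.trace_mul_comm _ _).symm
      _ = (M * T * (M * T')).trace := by simp only [Matrix.mul_assoc]
  rw [h1, h2]

/-- Forward then inverse-backward: `Σ_ij tr((XM)T)·tr((−MᵀX)T') = 2(tr(T T') − tr(M T M T'ᵀ))`. [folklore] -/
theorem sum_trace_mul_trace_fwd_bwd (M T T' : Matrix n n R) (hM : Mᵀ * M = 1) :
    ∑ i : n, ∑ j : n, (soDir i j * M * T).trace * (-(Mᵀ * soDir i j) * T').trace =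
      2 * ((T * T').trace - (M * T * (M * T'ᵀ)).trace) := by
  have h : ∀ (i j : n), (-(Mᵀ * soDir i j) * T').trace = -(soDir i j * (T' * Mᵀ)).trace := by
    intro i j
    rw [Matrix.neg_mul, Matrix.trace_neg, Matrix.mul_assoc, Matrix.trace_mul_comm, Matrix.mul_assoc]
  have h' : ∀ (i j : n), (soDir i j * M * T : Matrix n n R).trace = (soDir i j * (M * T)).trace := by
    intro i j; rw [Matrix.mul_assoc]
  simp only [h, h']
  simp only [mul_neg, Finset.sum_neg_distrib, sum_trace_soDir_mul_mul_trace_soDir_mul]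
  have h1 : (M * T * (T' * Mᵀ)ᵀ).trace = (M * T * (M * T'ᵀ)).trace := by
    rw [Matrix.transpose_mul, Matrix.transpose_transpose]
  have h2 : (M * T * (T' * Mᵀ)).trace = (T * T').trace := by
    calc (M * T * (T' * Mᵀ)).trace = (M * (T * T' * Mᵀ)).trace := by simp only [Matrix.mul_assoc]
      _ = (T * T' * Mᵀ * M).trace := Matrix.trace_mul_comm _ _
      _ = (T * T').trace := by rw [Matrix.mul_assoc (T * T'), hM, Matrix.mul_one]
  rw [h1, h2]
  ring

/-- Backward then inverse-forward: `Σ_ij tr((−MX)T)·tr((X Mᵀ)T') = 2(tr(T T') − tr(M T M T'ᵀ))`. [folklore] -/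
theorem sum_trace_mul_trace_bwd_fwd (M T T' : Matrix n n R) (hM' : M * Mᵀ = 1) :
    ∑ i : n, ∑ j : n, (-(M * soDir i j) * T).trace * (soDir i j * Mᵀ * T').trace =
      2 * ((T * T').trace - (M * T * (M * T'ᵀ)).trace) := by
  have h : ∀ (i j : n), (-(M * soDir i j) * T).trace = -(soDir i j * (T * M)).trace := by
    intro i j
    rw [Matrix.neg_mul, Matrix.trace_neg, Matrix.mul_assoc, Matrix.trace_mul_comm, Matrix.mul_assoc]
  have h' : ∀ (i j : n), (soDir i j * Mᵀ * T' : Matrix n n R).trace = (soDir i j * (Mᵀ * T')).trace := by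
    intro i j; rw [Matrix.mul_assoc]
  simp only [h, h']
  simp only [neg_mul, Finset.sum_neg_distrib, sum_trace_soDir_mul_mul_trace_soDir_mul]
  have h1 : (T * M * (Mᵀ * T')ᵀ).trace = (M * T * (M * T'ᵀ)).trace := by
    rw [Matrix.transpose_mul, Matrix.transpose_transpose]
    calc (T * M * (T'ᵀ * M)).trace = (T * M * T'ᵀ * M).trace := by simp only [Matrix.mul_assoc]
      _ = (M * (T * M * T'ᵀ)).trace := (Matrix.trace_mul_comm _ _).symm
      _ = (M * T * (M * T'ᵀ)).trace := by simp only [Matrix.mul_assoc]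
  have h2 : (T * M * (Mᵀ * T')).trace = (T * T').trace := by
    calc (T * M * (Mᵀ * T')).trace = (T * (M * Mᵀ) * T').trace := by simp only [Matrix.mul_assoc]
      _ = (T * T').trace := by rw [hM', Matrix.mul_one]
  rw [h1, h2]
  ring

end SOMasterLoop

end Summit.QuantumFields.GaugeBoot
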